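/-
Copyright (c) 2026 the pub-hodgecm-mathlib formalisation cell (harness21).  Prover seat hodgecm-mathlib-LH10-p01 (g10): road M6 «ROW 2 ★ DYADIC TWIN» (LEAD F0P3a-plan T14-66),
dealer LH4-plan (g8) WORD #48 (Q-f) ∕ #50 «F4-head-odd» = the W-ODD ∕ uniformiser-frame DYADIC-SAFE twin of ★ `DepthZeroKappaTransferTypeTwoRowTwoPlace.ncard_selfDual_cyclic_typeTwo_eq_ite_of_model`
(A-p19 (g26)) re-threaded on ★ p852817 (package) + ★ p852827 (parity) + ★ `TypeTwoUnitIndexAtPlaceWildOdd` (index) + ★ p851638 (seed); 2026-09-02.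
-/
import Literature.NumberTheory.Rogawski1990.TypeTwoEigenFieldPackageUniformiser  -- ★ p852817 (LH4-p01 (g9)) F4-a′: `exists_eigenField_package_uniformiser` (no `|2| = 1`; brings ★ (D2-β), ★ [T2-L], ★ Q2∕Q5)
import Literature.NumberTheory.Automorphic.TypeTwoSelfDualCyclicParityUniform   -- ★ p852827 (LH4-p01 (g9)) F4-b′: `SymmetricEigenframe.exists_selfDual_cyclic_iff_even_log_uniform` (no `|2| = 1`; brings ★ (D2-γ-CM), ★ p851636)
import Literature.NumberTheory.Rogawski1990.TypeTwoUnitIndexAtPlaceWildOdd       -- ★ (this seat) F4-c′: `exists_integers_relIndex_units_comap_norm_eq_place_wildOdd` (no `|2| = 1`; brings ★ (L3′), ★ (D5) and its place dictionary)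
import Literature.NumberTheory.LocalFields.UnramifiedQuadraticUnitTrace          -- ★ p851638 (B-p04): `UnramifiedQuadraticNorm.exists_v_eq_one_v_add_galAdicCompletionMap_eq_one` (the unit-trace seed `ω`, any residue characteristic)
import Literature.NumberTheory.LocalFields.InertPlaceSkewDiscriminantRoot         -- ★ p846675 (D2-α): `exists_isUnit_galAdicCompletionMap_sub`, `exists_mul_galAdicCompletionMap_mul_eq_one_of_even` (the 2-free halves only)
import Literature.NumberTheory.Automorphic.TypeTwoCommutantBridge                -- ★ p846662 (D3): `exists_algHom_prod`, `hstar_of_algHom_prod`, `exists_aeval_prod_eq`, `mem_adjoin_integer_iff_exists_mem_map`, `relIndex_units_map_prod_eq`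
import Literature.NumberTheory.Automorphic.CyclicSelfDualLatticeTorsor            -- ★ p846576 [T2-a]: `ncard_setOf_selfDual_cyclic_eq_relIndex`, `exists_units_of_mem`
import Literature.NumberTheory.Automorphic.ValuedFieldValuativeRelBridge          -- ★ `v_eq_iff_valuation_eq`, `v_le_one_iff_mem_integer`, …
import Literature.NumberTheory.NumberFields.QuadraticRamifiedAtOddValuationPlace  -- ★ Q3: `not_isSquare_of_valued_eq_exp_odd`
import Literature.NumberTheory.Automorphic.SplitTorusOrderFixedSidePlace          -- ★ Σ2-CM: `exists_isUnit_galAdicCompletionMap_sub`, residue cards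
import Literature.NumberTheory.LocalFields.UnramifiedQuadraticNormAtInertPlace    -- ★ `UnramifiedQuadraticNorm.exists_mul_map_eq_of_isUnit_integer`
import Literature.NumberTheory.Automorphic.Liu2021.LemD1AsPrintedIndexedNonVacuityInertCofinite   -- ★ `valued_toPlace_of_isUnramifiedIn`
import HarnessLib

/-!
# The depth-zero κ-transfer, type (2): ROW 2 at ONE PLACE, uniformiser frame, ANY residue characteristic (`p = 2` allowed) — given a global model of the eigen-field

Topic `NumberTheory/Rogawski1990`; namespace `Literature.NumberTheory.Rogawski1990`.  ONE THEOREM (no definition, no instance, no notation, no named fact, no `sorry`); kernel lane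
`--supports stmt-HodgeConjecture-24833`.  Cell `pub/hodgecm-mathlib` (D-0151), crux H413; road M6 «ROW 2 ★ DYADIC TWIN» (LEAD F0P3a-plan (g15) T14-66), dealer LH4-plan (g8)
WORD #48 (Q-f) ∕ #50: **F4-head-odd** = ★ `DepthZeroKappaTransferTypeTwoRowTwoPlace.ncard_selfDual_cyclic_typeTwo_eq_ite_of_model` (A-p19 (g26); inert place `w ∣ v` AWAY FROM 2,
binder `hv2 : |2|_w = 1`) RE-THREADED on the four dyadic-safe ★ inputs of tonight: the eigen-field package ★ `exists_eigenField_package_uniformiser` (p852817, F4-a′; replaces ★ (D2-β)),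
the parity criterion ★ `SymmetricEigenframe.exists_selfDual_cyclic_iff_even_log_uniform` (p852827, F4-b′; replaces ★ (D2-γ-CM)), the place index ★
`exists_integers_relIndex_units_comap_norm_eq_place_wildOdd` (F4-c′, this seat; replaces ★ (D5)) and the unit-trace seed ★ `exists_v_eq_one_v_add_galAdicCompletionMap_eq_one`
(p851638; replaces `b = ½`).  DIFFERENCES from ★ `…_of_model`: binder `hv2` DELETED; `{e : ℕ} (he : |2|_v = exp(−e))` (PARAMETER, `e = 0` tame) and `(hχ1 : |1 − t + D|_w < 1)` ADDED;
side condition `1 ≤ N + n ↦ 1 ≤ N − e + n`; VALUE `(q+1)·q^{N+n−1} ↦ (q+1)·q^{N−e+n−1}`; every other binder and the counted set ∕ parity condition IDENTICAL.  So: for a type-(2) unitary `τ`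
over the CM completion `E = L_w` at an inert-unramified place `w ∣ v` (dyadic allowed), with eigen-data `(u, t, D)`, `4D = t² − y²·ι k₀` (`k₀` a uniformiser of `L⁺_v`, `ord_w y = N`),
and a global quadratic `M ⊃ L` realising `L_w(√(ι k₀))` at `w₁ ∣ w`, the number of SELF-DUAL `τ`-CYCLIC lattices is **`(q+1)·q^{N−e+n−1}` if `ord_w d₀ + n` is even and `0` otherwise**
(`d₀ = ᵗσ(x₀)·J·x₀`, `q = N(v)`, `|2|_v = q^{−e}`).  Proof = ★'s, call for call: (D2-β) ↦ p852817 (obtain pattern + `⟨hpO, hqO⟩`), (D2-γ-CM) ↦ p852827 (CALL SHAPE frozen by LH4-p01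
22:10:43Z: drop `htr`, the skew unit, `hv2`; add `h20`, seed `ω`), (D5) ↦ `…_wildOdd` (`he`, `hχ1`, `hlamO hlam1`, exponent `N − e`), `htr` for ★ [T2-a] from the seed
(`b := ω∕(ω + σω)`), `2 ≠ 0` in `L_w` from `he` (a valuation is never `0` on `2`).  KILL discipline (T14-57∕66): no hypothesis excluding `p = 2`.
HONEST LABEL: HC_CM is proved only modulo the 7 printed citations (2 remaining named inputs: hLiu418 = stmt-HodgeConjecture-24832, h413 = stmt-HodgeConjecture-24833) until rung 0 closes;
unconditional local algebra, count-neutral ((D-UNR)∕(D-RAM) PRINT; pays no organ, opens no road; zero label movement until F5 ★ + a desk-priced rider).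

* **`ncard_selfDual_cyclic_typeTwo_eq_ite_of_model_wildOdd`** — F4-head-odd.

## References
* [Rogawski1990] J. D. Rogawski, *Automorphic Representations of Unitary Groups in Three Variables* (1990): §4.9 Lemma 4.9.3 p. 56, Prop. 4.9.1 (b) p. 55.
* [Kottwitz1986] R. E. Kottwitz, *Base change for unit elements of Hecke algebras*, Compositio Math. 60 (1986): §3.
* [Jacobowitz1962] R. Jacobowitz, *Hermitian forms over local fields*, Amer. J. Math. 84 (1962): §5, §7.
* [SerreLocalFields1979] J.-P. Serre, *Local Fields*, GTM 67 (1979): Ch. V §2 Prop. 3.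
-/

set_option autoImplicit false

noncomputable section

open NumberField IsDedekindDomain Matrix Polynomial Finset
open scoped MatrixGroups WithZero ValuativeRel

namespace Literature.NumberTheory.Rogawski1990

open ValuativeRel
open Literature.NumberTheory.Automorphic Literature.NumberTheory.Automorphic.UnitaryGroup

open Literature.NumberTheory.GaloisRepresentations Literature.NumberTheory.NumberFields

variable (L : Type) [Field L] [NumberField L] [IsCMField L] {v : HeightOneSpectrum (𝓞 ↥(maximalRealSubfield L))}

set_option synthInstance.maxHeartbeats 200000 in
set_option maxHeartbeats 1600000 in
/-- **ROW 2 AT ONE PLACE, UNIFORMISER FRAME, ANY RESIDUE CHARACTERISTIC, GIVEN A GLOBAL MODEL OF THE EIGEN-FIELD.**  For a type-(2) unitary `τ` over the CM completion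
`E = L_w` (inert-unramified `w ∣ v`, `|2|_v = exp(−e)`, `J` hyperspecial `σ_w`-hermitian; `χ_τ = (X − u)(X² − tX + D)`, `σu·u = 1`, `DσD = 1`, `σt = tσD`, `u ≡ 1`, `t ≡ 2`,
`1 − t + D ≡ 0`, `ord(u² − tu + D) = n`, `4D = t² − y²·ι k₀` with `k₀` a uniformiser of `L⁺_v`, `σy = −yσD`, `ord y = N`, `1 ≤ N − e + n`; cyclic vector `w₀`, rational `u`-eigenvector
`x₀`), and a quadratic number field `M ⊃ L` whose completion at `w₁ ∣ w` is `L_w(√(ι k₀))` (`c₁ δ₁ = −δ₁`, `m = δ₁²`, `(ι k₀)⁻¹ m ∈ (L_w^×)²`): the number of self-dual `τ`-cyclic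
lattices is `(q+1)·q^{N−e+n−1}` if `ord_w d₀ + n` is even (`d₀ = ᵗσ(x₀)·J·x₀`) and `0` otherwise.  Dyadic-safe twin of ★ `ncard_selfDual_cyclic_typeTwo_eq_ite_of_model`.
[cite: Rogawski1990, §4.9 Lemma 4.9.3 p. 56, Prop. 4.9.1 (b) p. 55] [cite: Kottwitz1986, §3] [cite: Jacobowitz1962, §5, §7] -/
theorem ncard_selfDual_cyclic_typeTwo_eq_ite_of_model_wildOdd (w : PlacesOver L v) (hw : IsCMField.complexConj L • w.1 = w.1)
    (hv : Algebra.IsUnramifiedIn (𝓞 L) v.asIdeal) {e : ℕ} (he : Valued.v (2 : v.adicCompletion ↥(maximalRealSubfield L)) = WithZero.exp (-(e : ℤ)))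
    (J : GL (Fin 3) (w.1.adicCompletion L)) (hJ : J ∈ glInt 3 (w.1.adicCompletion L))
    (hJh : ((J : Matrix (Fin 3) (Fin 3) (w.1.adicCompletion L)).map (galAdicCompletionMap (L := L) (IsCMField.complexConj L) hw))ᵀ = J)
    (τ : Matrix (Fin 3) (Fin 3) (w.1.adicCompletion L))
    (hτU : (τ.map (galAdicCompletionMap (L := L) (IsCMField.complexConj L) hw))ᵀ * (J : Matrix (Fin 3) (Fin 3) (w.1.adicCompletion L)) * τ = J)
    (hint : ∀ i, τ.charpoly.coeff i ∈ 𝒪[w.1.adicCompletion L])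
    {u t D : w.1.adicCompletion L} (hχ : τ.charpoly = (X - C u) * (X ^ 2 - C t * X + C D))
    (hσu : galAdicCompletionMap (L := L) (IsCMField.complexConj L) hw u * u = 1)
    (hσD : D * galAdicCompletionMap (L := L) (IsCMField.complexConj L) hw D = 1)
    (hσt : galAdicCompletionMap (L := L) (IsCMField.complexConj L) hw t = t * galAdicCompletionMap (L := L) (IsCMField.complexConj L) hw D)
    (hu1 : Valued.v (u - 1) < 1) (ht2 : Valued.v (t - 2) < 1) (hχ1 : Valued.v (1 - t + D) < 1)
    {n N : ℕ} (hn : Valued.v (u * u - t * u + D) = WithZero.exp (-(n : ℤ))) (hNn : 1 ≤ N - e + n)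
    {w₀ : Fin 3 → w.1.adicCompletion L} (hK : IsUnit (Matrix.of fun i j : Fin 3 => ((τ ^ (j : ℕ)) *ᵥ w₀) i).det)
    {x₀ : Fin 3 → w.1.adicCompletion L} (hx₀ : τ *ᵥ x₀ = u • x₀) (hx₀0 : x₀ ≠ 0)
    {y : w.1.adicCompletion L} {k₀ : v.adicCompletion ↥(maximalRealSubfield L)} (hk₀ : Valued.v k₀ = WithZero.exp (-1 : ℤ))
    (hD : 4 * D = t * t - y * y * toPlace v w k₀)
    (hσy : galAdicCompletionMap (L := L) (IsCMField.complexConj L) hw y = -(y * galAdicCompletionMap (L := L) (IsCMField.complexConj L) hw D))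
    (hN : Valued.v y = WithZero.exp (-(N : ℤ)))
    {M : Type} [Field M] [NumberField M] [Algebra L M] [Algebra.IsQuadraticExtension L M] (c₁ : M ≃ₐ[L] M) {δ₁ : M} (hcδ : c₁ δ₁ = -δ₁) (hδ₁ : δ₁ ≠ 0)
    {m : L} (hm : algebraMap L M m = δ₁ ^ 2) (hdm : IsSquare ((toPlace v w k₀)⁻¹ * (m : w.1.adicCompletion L))) (w₁ : PlacesOver M w.1) :
    {Λ : Submodule 𝒪[w.1.adicCompletion L] (Fin 3 → w.1.adicCompletion L) |
        (∃ g ∈ unitaryGroupOfForm (galAdicCompletionMap (L := L) (IsCMField.complexConj L) hw) (J : Matrix (Fin 3) (Fin 3) (w.1.adicCompletion L)),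
          Λ = Submodule.span 𝒪[w.1.adicCompletion L] (Set.range ((g : Matrix (Fin 3) (Fin 3) (w.1.adicCompletion L)))ᵀ)) ∧
        ∃ wv : Fin 3 → w.1.adicCompletion L, Λ = Submodule.span 𝒪[w.1.adicCompletion L] (Set.range fun j : Fin 3 => (τ ^ (j : ℕ)) *ᵥ wv)}.ncard =
      if Even (WithZero.log (Valued.v (∑ k, ∑ i, galAdicCompletionMap (L := L) (IsCMField.complexConj L) hw (x₀ i) *
            (J : Matrix (Fin 3) (Fin 3) (w.1.adicCompletion L)) i k * x₀ k)) + n) then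
        (Ideal.absNorm v.asIdeal + 1) * Ideal.absNorm v.asIdeal ^ (N - e + n - 1) else 0 := by
  classical
  haveI : Algebra.IsQuadraticExtension ↥(maximalRealSubfield L) L := IsCMField.isQuadraticExtension L
  have hc1 : IsCMField.complexConj L ≠ 1 := IsCMField.complexConj_ne_one L
  -- tokens at `w`: the inert dictionary (★ Σ2-CM, ★ (D2-α)'s 2-free halves)
  set σw := galAdicCompletionMap (L := L) (IsCMField.complexConj L) hw with hσw_def
  have hσσ := galAdicCompletionMap_galAdicCompletionMap_of_smul_eq (IsCMField.complexConj L) w hc1 hw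
  have hσO := mem_integer_galAdicCompletionMap (IsCMField.complexConj L) v w hw
  have hmoveU := Automorphic.exists_isUnit_galAdicCompletionMap_sub (IsCMField.complexConj L) v hc1 hv w hw
  have hmove := LocalFields.exists_isUnit_galAdicCompletionMap_sub L v w hw hv
  have hσv := valuation_galAdicCompletionMap_eq (IsCMField.complexConj L) v w hw
  have hσv' : ∀ x, Valued.v (σw x) = Valued.v x := fun x => (v_eq_iff_valuation_eq _ _).2 (hσv x)
  have hnormF := LocalFields.exists_mul_galAdicCompletionMap_mul_eq_one_of_even L v w hw hv
  have hιv : ∀ z : v.adicCompletion ↥(maximalRealSubfield L), Valued.v (toPlace v w z) = Valued.v z :=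
    fun z => Liu2021.LemD1IndexedNonVacuityInertCofinite.valued_toPlace_of_isUnramifiedIn L v hv w z
  -- `2 ≠ 0` in `L_w`: its valuation is `exp(−e) ≠ 0` (NO `|2| = 1`)
  have h2v : Valued.v (2 : w.1.adicCompletion L) = WithZero.exp (-(e : ℤ)) := by rw [← map_ofNat (toPlace v w) 2, hιv, he]
  have h20 : (2 : w.1.adicCompletion L) ≠ 0 := by
    intro h; rw [h, map_zero] at h2v; exact WithZero.zero_ne_coe h2v
  -- the unit-trace seed `ω` (★ p851638) and the trace-one element `b = ω∕(ω + σω)` of ★ [T2-a]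
  obtain ⟨ω, hωv, hωtr⟩ := LocalFields.UnramifiedQuadraticNorm.exists_v_eq_one_v_add_galAdicCompletionMap_eq_one L v w hw hv
  have hωs0 : ω + σw ω ≠ 0 := fun h0 => by rw [h0, map_zero] at hωtr; exact zero_ne_one hωtr
  have htr : ∃ b : 𝒪[w.1.adicCompletion L], (b : w.1.adicCompletion L) + σw b = 1 := by
    have hbO : ω / (ω + σw ω) ∈ 𝒪[w.1.adicCompletion L] := (v_le_one_iff_mem_integer _).1 (by
      rw [map_div₀, hωv, hωtr, div_one])
    refine ⟨⟨ω / (ω + σw ω), hbO⟩, ?_⟩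
    change ω / (ω + σw ω) + σw (ω / (ω + σw ω)) = 1
    rw [map_div₀, map_add, hσσ, add_comm (σw ω) ω, ← add_div, div_self hωs0]
  have hnorm : ∀ u : 𝒪[w.1.adicCompletion L], IsUnit u → σw u = u → ∃ s : 𝒪[w.1.adicCompletion L], (s : w.1.adicCompletion L) * σw s = u :=
    fun u hu hσu => LocalFields.UnramifiedQuadraticNorm.exists_mul_map_eq_of_isUnit_integer σw hσσ hσO hmoveU u hu hσu
  -- `d = ι k₀`: a `σ_w`-fixed uniformiser of `L_w`
  have hdv : Valued.v (toPlace v w k₀) = WithZero.exp (-1 : ℤ) := by rw [hιv, hk₀]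
  have hσd : σw (toPlace v w k₀) = toPlace v w k₀ := galAdicCompletionMap_toPlace (IsCMField.complexConj L) w w hw k₀
  have hdnsq : ¬ IsSquare (toPlace v w k₀) :=
    not_isSquare_of_valued_eq_exp_odd (-1) (by rw [hdv]; norm_num)
  -- elementary consequences of the eigen-data
  have hy0 : y ≠ 0 := fun h0 => by rw [h0, map_zero] at hN; exact WithZero.zero_ne_coe hN
  have hu0 : u ≠ 0 := fun h0 => by rw [h0, mul_zero] at hσu; exact zero_ne_one hσu
  have hD0 : D ≠ 0 := fun h0 => by rw [h0, zero_mul] at hσD; exact zero_ne_one hσD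
  have hχu : u * u - t * u + D ≠ 0 := fun h0 => by rw [h0, map_zero] at hn; exact WithZero.zero_ne_coe hn
  have hirr : ∀ x : w.1.adicCompletion L, x * x - t * x + D ≠ 0 := by
    intro x hx
    refine hdnsq ⟨(2 * x - t) / y, ?_⟩
    field_simp
    linear_combination hD - 4 * hx
  set e₂ : w.1.adicCompletion L := 2⁻¹ with he₂
  have h2e : e₂ * 2 = 1 := inv_mul_cancel₀ h20
  have hτu : IsUnit τ.det := by
    rw [isUnit_iff_ne_zero, Matrix.det_eq_sign_charpoly_coeff, Polynomial.coeff_zero_eq_eval_zero, hχ]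
    simp only [eval_mul, eval_sub, eval_add, eval_X, eval_C, eval_pow, Fintype.card_fin]
    have : (-1 : w.1.adicCompletion L) ^ 3 * ((0 - u) * (0 ^ 2 - t * 0 + D)) = u * D := by ring
    rw [this]
    exact mul_ne_zero hu0 hD0
  have hfτ : aeval τ (C 1 * X ^ 3 + C (-(t + u)) * X ^ 2 + C (D + t * u) * X + C (-(u * D))) = 0 := by
    have h := Matrix.aeval_self_charpoly τ
    rw [hχ] at h
    have hf : (C 1 * X ^ 3 + C (-(t + u)) * X ^ 2 + C (D + t * u) * X + C (-(u * D)) : (w.1.adicCompletion L)[X]) =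
        (X - C u) * (X ^ 2 - C t * X + C D) := by
      simp only [map_one, map_neg, map_add, map_mul, one_mul]
      ring
    rw [hf]
    exact h
  -- ★ p852817: the eigen-field package at `w₁`, uniformiser frame, no `|2| = 1`
  obtain ⟨θ, s', ι', ⟨hθ, hθv, hcoord, hintK⟩, ⟨hs'ι, hs'θ, hs's', hs'O, hs'v⟩, ⟨hι'ι, hι'θ, hι'ι', hι'O, hι'v, hcomm⟩,
      ⟨hquad, hlamO, hlam1, hnorm1, hι'lam, hne, hexpn, hexpN⟩, ⟨hrE, hnK, hnE⟩, -⟩ :=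
    exists_eigenField_package_uniformiser M w.1 c₁ hcδ hδ₁ hm hdv hdm w₁ σw hσσ hσd hσv' hmove hnormF u t D y e₂ h2e hD hσD hσt hσy hn hN ht2 hχ1
  have hs'v' : ∀ z, valuation (w₁.1.adicCompletion M) (s' z) = valuation (w₁.1.adicCompletion M) z :=
    fun z => (v_eq_iff_valuation_eq _ _).1 (hs'v z)
  -- the ramified embedding `ι₁ = toPlace w w₁`
  have heram : (w.1).asIdeal.ramificationIdx' w₁.1.asIdeal = 2 := ramificationIdx'_eq_two_of_uniformizer M w.1 c₁ hcδ hδ₁ hm hdv hdm w₁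
  have hjv : ∀ x, Valued.v (toPlace w.1 w₁ x) = Valued.v x ^ 2 := valued_toPlace_of_ramificationIdx'_eq_two M w.1 w₁ heram
  -- ★ p852827: non-emptiness ⟺ parity, no `|2| = 1` (seed `ω`)
  have hgood := SymmetricEigenframe.exists_selfDual_cyclic_iff_even_log_uniform σw hσσ hσO hnorm h20 hωv.le hωtr J hJ hJh τ hτU hχ hσu hu1
    hx₀ hx₀0 (toPlace w.1 w₁) hjv s' ι' hs'ι hs's' hs'v hι'ι hι'ι' hι'v hcomm hθv hι'θ hcoord hquad hlamO hlam1 hnorm1 hne hexpn hexpN hrE hnK hnE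
  by_cases hex : ∃ wv : Fin 3 → w.1.adicCompletion L, ∃ g ∈ unitaryGroupOfForm σw (J : Matrix (Fin 3) (Fin 3) (w.1.adicCompletion L)),
      Submodule.span 𝒪[w.1.adicCompletion L] (Set.range fun k : Fin 3 => (τ ^ (k : ℕ)) *ᵥ wv) =
        Submodule.span 𝒪[w.1.adicCompletion L] (Set.range ((g : Matrix (Fin 3) (Fin 3) (w.1.adicCompletion L)))ᵀ)
  swap
  · -- EMPTY CASE
    rw [if_neg (fun h => hex (hgood.2 h))]
    have hS : {Λ : Submodule 𝒪[w.1.adicCompletion L] (Fin 3 → w.1.adicCompletion L) |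
        (∃ g ∈ unitaryGroupOfForm σw (J : Matrix (Fin 3) (Fin 3) (w.1.adicCompletion L)),
          Λ = Submodule.span 𝒪[w.1.adicCompletion L] (Set.range ((g : Matrix (Fin 3) (Fin 3) (w.1.adicCompletion L)))ᵀ)) ∧
        ∃ wv : Fin 3 → w.1.adicCompletion L, Λ = Submodule.span 𝒪[w.1.adicCompletion L] (Set.range fun j : Fin 3 => (τ ^ (j : ℕ)) *ᵥ wv)} = ∅ := by
      ext Λ
      simp only [Set.mem_setOf_eq, Set.mem_empty_iff_false, iff_false, not_and]
      rintro ⟨g, hg, hΛg⟩ ⟨wv, hΛw⟩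
      exact hex ⟨wv, g, hg, hΛw.symm.trans hΛg⟩
    rw [hS, Set.ncard_empty]
  -- NON-EMPTY CASE: the torsor count
  rw [if_pos (hgood.1 hex)]
  have hσu' : u * σw u = 1 := by rw [mul_comm]; exact hσu
  -- ★ (D3): the bridge `φ : L_w × K →ₐ M₃(L_w)`
  letI : Algebra (w.1.adicCompletion L) (w₁.1.adicCompletion M) := (toPlace w.1 w₁).toAlgebra
  have halg : algebraMap (w.1.adicCompletion L) (w₁.1.adicCompletion M) = toPlace w.1 w₁ := RingHom.algebraMap_toAlgebra _
  set lam : w₁.1.adicCompletion M := (toPlace w.1 w₁ t + toPlace w.1 w₁ y * θ) * toPlace w.1 w₁ e₂ with hlam_def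
  have hlam' : lam ^ 2 - algebraMap (w.1.adicCompletion L) (w₁.1.adicCompletion M) t * lam +
      algebraMap (w.1.adicCompletion L) (w₁.1.adicCompletion M) D = 0 := by
    rw [halg]; exact hquad
  have hι2 : toPlace w.1 w₁ e₂ * 2 = 1 := by rw [← map_ofNat (toPlace w.1 w₁) 2, ← map_mul, h2e, map_one]
  have hιy : toPlace w.1 w₁ y ≠ 0 := (_root_.map_ne_zero _).2 hy0
  have hcoordlam : ∀ z : w₁.1.adicCompletion M, ∃ p q : w.1.adicCompletion L,
      z = algebraMap (w.1.adicCompletion L) (w₁.1.adicCompletion M) p + algebraMap (w.1.adicCompletion L) (w₁.1.adicCompletion M) q * lam := by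
    intro z
    obtain ⟨pq, hpq, -⟩ := hcoord z
    refine ⟨pq.1 - pq.2 * t / y, 2 * pq.2 / y, ?_⟩
    rw [halg, hpq, hlam_def, map_sub, map_div₀, map_mul, map_div₀, map_mul, map_ofNat]
    field_simp
    linear_combination (-(toPlace w.1 w₁ pq.2 * θ * toPlace w.1 w₁ y + toPlace w.1 w₁ pq.2 * toPlace w.1 w₁ t)) * hι2
  obtain ⟨φ, hφ, hφx⟩ := exists_algHom_prod u t D lam τ hfτ hK hlam' hirr hχu hcoordlam
  -- the adjoint relation (★ (D3) `hstar_of_algHom_prod`)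
  have hσK : ∀ x, s' (algebraMap (w.1.adicCompletion L) (w₁.1.adicCompletion M) x) =
      algebraMap (w.1.adicCompletion L) (w₁.1.adicCompletion M) (σw x) := by
    intro x; rw [halg]; exact hs'ι x
  have hx1 : ((u, lam) : w.1.adicCompletion L × w₁.1.adicCompletion M) * (σw u, s' lam) = 1 :=
    Prod.ext hσu' hnorm1
  have hall := exists_aeval_prod_eq u t D lam hχu hcoordlam hlam'
  have hstar := hstar_of_algHom_prod u lam σw s' hσK τ (J : Matrix (Fin 3) (Fin 3) (w.1.adicCompletion L)) hτU hτu hx1 hall φ hφx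
  -- ★ F4-c′: the integral order and its index (level `N − e`)
  obtain ⟨ιO, σO, jO, σ₁O, uO, tO, yO, DO, pO, qO, lamO, thetaO, -, hσOc, hjOc, hσ₁Oc, huO, -, -, -, -, -, -, hlamO', -, -, hidx⟩ :=
    exists_integers_relIndex_units_comap_norm_eq_place_wildOdd (IsCMField.complexConj L) v hc1 hv w hw he w₁ hk₀ s' hθ hcoord hintK hs'ι hs'θ hs'O hs'v hnK
      u t D y e₂ hu1 h2e hD hσu' hσD hσt hσy hn hN hχ1 hlamO hlam1 hNn
  -- the order `RB = incl R` and `φ(RB) = 𝒪[τ]` (★ (D3) `mem_adjoin_integer_iff_exists_mem_map`)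
  have hjO' : ∀ x : 𝒪[w.1.adicCompletion L], ((jO x : 𝒪[w₁.1.adicCompletion M]) : w₁.1.adicCompletion M) =
      algebraMap (w.1.adicCompletion L) (w₁.1.adicCompletion M) x := by
    intro x; rw [halg]; exact hjOc x
  have hφx' : φ ((((uO : 𝒪[w.1.adicCompletion L]) : w.1.adicCompletion L), ((lamO : 𝒪[w₁.1.adicCompletion M]) : w₁.1.adicCompletion M)) :
      w.1.adicCompletion L × w₁.1.adicCompletion M) = τ := by
    rw [huO, hlamO']; exact hφx
  have hRB := mem_adjoin_integer_iff_exists_mem_map jO hjO' uO lamO τ φ hφx'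
  -- a good unit `b₀` from the non-empty set (★ [T2-a] `exists_units_of_mem`)
  obtain ⟨wv, g, hg, hwg⟩ := hex
  obtain ⟨b₀, hb₀, -⟩ := exists_units_of_mem σw J τ hK φ hφ ((u, lam) : w.1.adicCompletion L × w₁.1.adicCompletion M) hφx
    (Λ := Submodule.span 𝒪[w.1.adicCompletion L] (Set.range ((g : Matrix (Fin 3) (Fin 3) (w.1.adicCompletion L)))ᵀ)) ⟨⟨g, hg, rfl⟩, wv, hwg.symm⟩
  -- ★ [T2-a]: the torsor count, then ★ (D3): transport of the index to `𝒪_w × 𝒪[K]`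
  rw [← hidx, ncard_setOf_selfDual_cyclic_eq_relIndex σw hσσ hσO htr hnorm J hJ hJh τ hint hK φ hφ
    ((u, lam) : w.1.adicCompletion L × w₁.1.adicCompletion M) hφx (RingHom.prodMap σw s') hstar _ hRB b₀ hb₀]
  exact relIndex_units_map_prod_eq jO uO lamO σO σw hσOc σ₁O s' hσ₁Oc hσv hs'v'

end Literature.NumberTheory.Rogawski1990

end
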